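import Summits.BirchSwinnertonDyer.BirchSwinnertonDyer.Theorems.GenusKolyvaginAtTwoGenusPrimitiveSupplyAtTwoConjugationTypeAtTwo

/-!
# Route `GenusKolyvaginAtTwo`, crux `GenusPrimitiveSupplyAtTwo` (stmt-BirchSwinnertonDyer-22136):
# the `Δ_E < 0` side — complex conjugation (hence a Gross–Kolyvagin Frobenius at `2`) is a TRANSPOSITION on `E[2]`

Seat `bsd-line-gk2-p3` g5 (cell `bsd-f1-sign2`). Summit-side THEOREM-ONLY file, companion of
`…ConjugationTypeAtTwo.lean` (the `Δ_E > 0` side: conjugation fixes `E[2]`), `--supports stmt-BirchSwinnertonDyer-22136`.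

* `exists_isRoot_twoTorsionPolynomial_smul_eq` — a complex conjugation fixes SOME root of the `2`-division cubic
  (three roots, orbits of an involution have size `≤ 2`).
* `twoTorsion_smul_eq_of_smul_x_eq` — a `2`-torsion point whose abscissa is `c₀`-fixed is `c₀`-fixed.
* `natCard_twoTorsion_fixed_eq_two_of_Δ_neg` — **`Δ < 0` ⇒ `#E(ℚ̄)[2]^{c₀} = 2`**: the fixed points form a subgroup of
  `E[2] ≅ (ℤ/2)²` (Silverman III.6.4(b)) that is proper (the sibling route's
  `KolyvaginEigenTwo.exists_twoTorsion_smul_ne_of_Δ_neg`) and non-trivial (the fixed root carries a point of order 2):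
  the transposition type, `dim_{𝔽₂} E[2]^{c₀} = 1`.
* `natCard_twoTorsion_reductionAt_eq_two_of_frobEqFrobInfty_of_Δ_neg` — **at a Gross–Kolyvagin prime
  (`FrobEqFrobInfty W K 2 ℓ`) of a `Δ < 0` globally minimal curve, `#Ẽ_v(k_v)[2] = 2`** (`r_ℓ = 1`: the cubic has exactly
  one root mod `ℓ`, `dim E(ℚ_ℓ)[2] = 1` — Mazur–Rubin's «the 2-Selmer rank moves by ±1» situation, and Tamagawa number
  `c_ℓ = 2` for the genus twists by `ℓ*`), by the transport of the companion file's §4 (reduction of torsion,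
  Frobenii agree on `E[2]` up to inertia).

With the companion file this is the kernel-checked dichotomy behind verdicts (R1)/(R2) of the seat's BSD-side ledger of
the open kernel U (crux workfile `Cruxes/GenusPrimitiveSupplyAtTwo/Lines/genus-supply-u-ledger.md`): at Gross-form
Kolyvagin primes the genus twists have `c_ℓ = 4` when `Δ_E > 0` and `c_ℓ = 2` when `Δ_E < 0`. Nothing about `Ш`; no item
closed; BSD is not proved by any of this.
References: [SilvermanAEC2009] III.1, III.2.3(d), Cor. III.6.4(b), Prop. VII.3.1(b), Prop. VII.4.1(a); [GrossLMS1991] §3 (3.2);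
[MazurRubin2010] Prop. 3.3 (the use of `dim E(ℚ_ℓ)[2] = 1`).
-/

set_option autoImplicit false
set_option linter.dupNamespace false

noncomputable section

open scoped Classical

namespace Summit.BirchSwinnertonDyer.BirchSwinnertonDyer.Theorems.GenusKolySign

open Polynomial WeierstrassCurve Field
open Literature.NumberTheory.EllipticCurves Literature.NumberTheory.GaloisRepresentations
open Literature.NumberTheory.EllipticCurves.Rank1Residual
open Summit.BirchSwinnertonDyer.BirchSwinnertonDyer.Theorems.KolyvaginEigenTwo
  (exists_point_two_smul_eq_zero_of_isRoot exists_twoTorsion_smul_ne_of_Δ_neg)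
open IsDedekindDomain NumberField

variable (W : WeierstrassCurve ℚ) [W.IsElliptic]

/-! ### §1 `Δ < 0`: conjugation fixes exactly one root, so `#E[2]^{c₀} = 2` and `#Ẽ(𝔽_ℓ)[2] = 2` at a Gross prime -/

/-- **An involution of `Gal(ℚ̄/ℚ)` fixes a root of the `2`-division cubic** (three roots, orbits of a
complex conjugation have size `≤ 2`): if `c₀` moves the root `x` to `x'`, the remaining root is fixed.
[cite: SilvermanAEC2009, III.1] -/
theorem exists_isRoot_twoTorsionPolynomial_smul_eq {c₀ : absoluteGaloisGroup ℚ}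
    (hc₀ : IsComplexConjugation (Rat.castHom ℝ) c₀) :
    ∃ x : AlgebraicClosure ℚ,
      (Cubic.map (algebraMap ℚ (AlgebraicClosure ℚ)) W.twoTorsionPolynomial).toPoly.IsRoot x ∧ c₀ • x = x := by
  set C := Cubic.map (algebraMap ℚ (AlgebraicClosure ℚ)) W.twoTorsionPolynomial with hC
  have ha : W.twoTorsionPolynomial.a ≠ 0 := by change (4 : ℚ) ≠ 0; norm_num
  have hsplit : (W.twoTorsionPolynomial.toPoly.map (algebraMap ℚ (AlgebraicClosure ℚ))).Splits :=
    IsAlgClosed.splits _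
  obtain ⟨e₁, e₂, e₃, h3⟩ := (Cubic.splits_iff_roots_eq_three ha).mp hsplit
  have ha' : C.a ≠ 0 := by
    change algebraMap ℚ (AlgebraicClosure ℚ) W.twoTorsionPolynomial.a ≠ 0
    exact (_root_.map_ne_zero _).mpr ha
  have hne0 : C.toPoly ≠ 0 := Cubic.ne_zero_of_a_ne_zero ha'
  have hcard : Multiset.card C.roots = 3 := by rw [h3]; rfl
  have he₁ : e₁ ∈ C.roots := by rw [h3]; simp
  by_cases hfix : c₀ • e₁ = e₁
  · exact ⟨e₁, (mem_roots hne0).mp he₁, hfix⟩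
  -- `x = e₁` is moved to the root `x' ≠ x`; the third root `x''` is fixed
  set x := e₁ with hxdef
  set x' := c₀ • e₁ with hx'
  have hxm : x ∈ C.roots := he₁
  have hx'm : x' ∈ C.roots :=
    (mem_roots hne0).mpr (isRoot_twoTorsionPolynomial_smul W c₀ ((mem_roots hne0).mp he₁))
  have hx'x : x' ≠ x := hfix
  have hcx' : c₀ • x' = x := smul_smul_eq_of_isComplexConjugation hc₀ x
  have h1 : C.roots = x ::ₘ C.roots.erase x := (Multiset.cons_erase hxm).symm
  have hx'm1 : x' ∈ C.roots.erase x := (Multiset.mem_erase_of_ne hx'x).mpr hx'm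
  have h2 : C.roots.erase x = x' ::ₘ (C.roots.erase x).erase x' := (Multiset.cons_erase hx'm1).symm
  have hcard1 : Multiset.card ((C.roots.erase x).erase x') = 1 := by
    have := Multiset.card_erase_of_mem hx'm1
    rw [Multiset.card_erase_of_mem hxm, hcard] at this
    simpa using this
  obtain ⟨x'', hx''⟩ := Multiset.card_eq_one.mp hcard1
  have h3' : C.roots = {x, x', x''} := by rw [h1, h2, hx'']; rfl
  have hdisc0 : W.twoTorsionPolynomial.discr ≠ 0 := by
    rw [twoTorsionPolynomial_discr]
    have : W.Δ ≠ 0 := by rw [← coe_Δ']; exact W.Δ'.ne_zero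
    positivity
  have hnodup : C.roots.Nodup := (Cubic.discr_ne_zero_iff_roots_nodup ha hsplit).mp hdisc0
  have hnd : x ≠ x' ∧ x ≠ x'' ∧ x' ≠ x'' := by
    rw [h3'] at hnodup
    simp only [Multiset.insert_eq_cons, Multiset.nodup_cons, Multiset.mem_cons, Multiset.mem_singleton,
      not_or] at hnodup
    exact ⟨hnodup.1.1, hnodup.1.2, hnodup.2.1⟩
  have hx''m : x'' ∈ C.roots := by rw [h3']; simp
  refine ⟨x'', (mem_roots hne0).mp hx''m, ?_⟩
  have hm : c₀ • x'' ∈ C.roots :=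
    (mem_roots hne0).mpr (isRoot_twoTorsionPolynomial_smul W c₀ ((mem_roots hne0).mp hx''m))
  rw [h3'] at hm
  simp only [Multiset.insert_eq_cons, Multiset.mem_cons, Multiset.mem_singleton] at hm
  rcases hm with hm | hm | hm
  · exfalso; apply hnd.2.2
    have := congrArg (fun z ↦ c₀ • z) hm
    simp only [smul_smul_eq_of_isComplexConjugation hc₀] at this
    exact (this.trans hx'.symm).symm
  · exfalso; apply hnd.2.1
    have := congrArg (fun z ↦ c₀ • z) hm
    simp only [smul_smul_eq_of_isComplexConjugation hc₀] at this
    exact (this.trans hcx').symm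
  · exact hm

/-- **A `2`-torsion point with `c₀`-fixed abscissa is `c₀`-fixed** (its ordinate is `−(a₁x + a₃)/2`).
[cite: SilvermanAEC2009, III.2.3 (d)] -/
theorem twoTorsion_smul_eq_of_smul_x_eq {c₀ : absoluteGaloisGroup ℚ} (v : geomTorsion W ((2 : ℕ) : ℤ))
    (hfix : ∀ (x y : AlgebraicClosure ℚ) (h : (W.baseChange (AlgebraicClosure ℚ)).toAffine.Nonsingular x y),
      (v : geomPoints W) = Affine.Point.some x y h → c₀ • x = x) : c₀ • v = v := by
  apply Subtype.ext
  have hv2 : ((2 : ℕ) : ℤ) • (v : geomPoints W) = 0 := (mem_geomTorsion_iff W _ (v : geomPoints W)).mp v.2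
  change c₀ • (v : geomPoints W) = v
  rcases hP : (v : geomPoints W) with _ | ⟨x, y, h⟩
  · exact smul_zero c₀
  · rw [hP] at hv2
    have hv2' : (2 : ℤ) • (show geomPoints W from Affine.Point.some x y h) = 0 := by exact_mod_cast hv2
    obtain ⟨-, hlin⟩ := isRoot_twoTorsionPolynomial_of_two_smul_eq_zero W hv2'
    have hx : c₀ • x = x := hfix x y h hP
    set W' := W.baseChange (AlgebraicClosure ℚ) with hW'
    have hσ : ∀ z : AlgebraicClosure ℚ, c₀ • z = absoluteGaloisGroup.toAlgEquiv ℚ c₀ z := fun _ ↦ rfl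
    have ha₁ : W'.a₁ = ((W.a₁ : ℚ) : AlgebraicClosure ℚ) := eq_ratCast (algebraMap ℚ (AlgebraicClosure ℚ)) _
    have ha₃ : W'.a₃ = ((W.a₃ : ℚ) : AlgebraicClosure ℚ) := eq_ratCast (algebraMap ℚ (AlgebraicClosure ℚ)) _
    have hyx : y = -(W'.a₁ * x + W'.a₃) / 2 := by linear_combination hlin / 2
    have hy : c₀ • y = y := by
      rw [hσ] at hx ⊢
      conv_lhs => rw [hyx, ha₁, ha₃]
      conv_rhs => rw [hyx, ha₁, ha₃]
      simp only [map_div₀, map_neg, map_add, map_mul, map_ratCast, map_ofNat, hx]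
    set P : geomPoints W := Affine.Point.some x y h with hPdef
    have hmap : c₀ • P = Affine.Point.map ((absoluteGaloisGroup.toAlgEquiv ℚ c₀).toAlgHom) P := rfl
    rw [hmap, hPdef, Affine.Point.map_some]
    rw [hσ] at hx hy
    congr 1

/-- **`Δ < 0` ⇒ complex conjugation fixes exactly TWO points of `E[2]`** (`0` and the point with the one
real abscissa): the fixed points form a subgroup of `E[2] ≅ (ℤ/2)²` (order `4`, Silverman III.6.4(b)) which is
proper (the sibling's `exists_twoTorsion_smul_ne_of_Δ_neg`) and non-trivial (§5's fixed root carries a fixed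
point of order `2`). So `dim_{𝔽₂} E[2]^{c₀} = 1`: the transposition type. [cite: SilvermanAEC2009, III.1, Cor. III.6.4(b)] -/
theorem natCard_twoTorsion_fixed_eq_two_of_Δ_neg (hΔ : W.Δ < 0) {c₀ : absoluteGaloisGroup ℚ}
    (hc₀ : IsComplexConjugation (Rat.castHom ℝ) c₀) :
    Nat.card {P : geomTorsion W ((2 : ℕ) : ℤ) // c₀ • P = P} = 2 := by
  haveI : Fact (Nat.Prime 2) := ⟨Nat.prime_two⟩
  have hE : Nat.card (geomTorsion W ((2 : ℕ) : ℤ)) = 2 ^ 2 :=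
    card_torsionPoints_eq_sq_holds W (AlgebraicClosure ℚ) (by norm_num)
  haveI hfin : Finite (geomTorsion W ((2 : ℕ) : ℤ)) := Nat.finite_of_card_ne_zero (by rw [hE]; norm_num)
  -- the fixed points as the kernel of `c₀ - 1`
  set f : geomTorsion W ((2 : ℕ) : ℤ) →+ geomTorsion W ((2 : ℕ) : ℤ) :=
    (DistribSMul.toAddMonoidHom (geomTorsion W ((2 : ℕ) : ℤ)) c₀) - AddMonoidHom.id _ with hf
  have hker : ∀ P, P ∈ f.ker ↔ c₀ • P = P := fun P ↦ by
    rw [AddMonoidHom.mem_ker, hf, AddMonoidHom.sub_apply, sub_eq_zero]; rfl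
  have hcardK : Nat.card f.ker = Nat.card {P : geomTorsion W ((2 : ℕ) : ℤ) // c₀ • P = P} :=
    Nat.card_congr (Equiv.subtypeEquivRight fun P ↦ hker P)
  rw [← hcardK]
  -- `#ker ∣ 4`
  have hdvd : Nat.card f.ker ∣ 2 ^ 2 := hE ▸ f.ker.card_addSubgroup_dvd_card
  obtain ⟨k, hk, hkeq⟩ := (Nat.dvd_prime_pow Nat.prime_two).mp hdvd
  -- `ker ≠ ⊤`: some `2`-torsion point is moved
  have hne4 : Nat.card f.ker ≠ 2 ^ 2 := by
    intro h4
    obtain ⟨v, hv⟩ := exists_twoTorsion_smul_ne_of_Δ_neg W hΔ hc₀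
    have htop : f.ker = ⊤ := AddSubgroup.eq_top_of_card_eq _ (h4.trans hE.symm)
    have : (v : geomTorsion W ((2 : ℕ) : ℤ)) ∈ f.ker := by rw [htop]; exact AddSubgroup.mem_top _
    exact hv ((hker _).mp this)
  -- `ker ≠ ⊥`: the fixed root carries a non-zero fixed `2`-torsion point
  have hne1 : Nat.card f.ker ≠ 1 := by
    intro h1
    obtain ⟨x, hx, hcx⟩ := exists_isRoot_twoTorsionPolynomial_smul_eq W hc₀
    have hx' : (W.baseChange (AlgebraicClosure ℚ)).twoTorsionPolynomial.toPoly.IsRoot x := by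
      have hcub : Cubic.map (algebraMap ℚ (AlgebraicClosure ℚ)) W.twoTorsionPolynomial =
          (W.baseChange (AlgebraicClosure ℚ)).twoTorsionPolynomial := by
        simp [baseChange, twoTorsionPolynomial, Cubic.map, map_b₂, map_b₄, map_b₆, map_ofNat]
      rw [← hcub]; exact hx
    obtain ⟨y, hns, h2⟩ := exists_point_two_smul_eq_zero_of_isRoot W hx'
    set P : geomPoints W := Affine.Point.some x y hns with hP
    have hPmem : P ∈ geomTorsion W ((2 : ℕ) : ℤ) := (mem_geomTorsion_iff W _ P).mpr (by exact_mod_cast h2)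
    have hPfix : c₀ • (⟨P, hPmem⟩ : geomTorsion W ((2 : ℕ) : ℤ)) = ⟨P, hPmem⟩ :=
      twoTorsion_smul_eq_of_smul_x_eq W ⟨P, hPmem⟩ (fun x₁ y₁ h₁ he ↦ by
        have he' : Affine.Point.some x y hns = Affine.Point.some x₁ y₁ h₁ := he
        injection he' with hx₁ _
        rw [← hx₁]; exact hcx)
    have hPker : (⟨P, hPmem⟩ : geomTorsion W ((2 : ℕ) : ℤ)) ∈ f.ker := (hker _).mpr hPfix
    have h0ker : (0 : geomTorsion W ((2 : ℕ) : ℤ)) ∈ f.ker := f.ker.zero_mem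
    have hsub : Subsingleton f.ker := (Nat.card_eq_one_iff_unique.mp h1).1
    have hP0 : (⟨⟨P, hPmem⟩, hPker⟩ : f.ker) = ⟨0, h0ker⟩ := Subsingleton.elim _ _
    have hPz : P = 0 := congrArg Subtype.val (congrArg Subtype.val hP0)
    have hPne : P ≠ 0 := by rw [hP]; exact Affine.Point.some_ne_zero hns
    exact hPne hPz
  interval_cases k
  · exact absurd hkeq hne1
  · exact hkeq
  · exact absurd hkeq hne4

/-- **`#Ẽ(𝔽_ℓ)[2] = 2` at a Gross–Kolyvagin prime of a `Δ < 0` curve** (`W/ℚ` globally minimal, `ℓ` odd of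
good reduction, Gross's (3.2) `FrobEqFrobInfty W K 2 ℓ`): the `2`-division cubic has exactly one root mod `ℓ`
(`r_ℓ = 1`, `dim E(ℚ_ℓ)[2] = 1` — Mazur–Rubin's «Selmer rank moves by ±1» situation; Tate: the genus twists by
`ℓ*` are I₀* with `c_ℓ = 2`). Same transport as §4 with §5's count. [cite: SilvermanAEC2009, Prop. VII.3.1(b),
Prop. VII.4.1(a), Cor. III.6.4(b)] [cite: GrossLMS1991, §3 (3.2)] -/
theorem natCard_twoTorsion_reductionAt_eq_two_of_frobEqFrobInfty_of_Δ_neg [W.IsGloballyMinimal]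
    (hΔ : W.Δ < 0) {K : Type} [Field K] [NumberField K] {ℓ : ℕ} [Fact ℓ.Prime] (hℓ2 : ℓ ≠ 2)
    (hgoodℓ : W.HasGoodReductionAtPrime ℓ) (hℓ : FrobEqFrobInfty W K 2 ℓ)
    {v : IsDedekindDomain.HeightOneSpectrum (NumberField.RingOfIntegers ℚ)}
    (hv : (ℓ : NumberField.RingOfIntegers ℚ) ∈ v.asIdeal) :
    Nat.card (AddSubgroup.torsionBy (W.reductionAt v).toAffine.Point ((2 : ℕ) : ℤ)) = 2 := by
  haveI : Fact (Nat.Prime 2) := ⟨Nat.prime_two⟩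
  have hℓp : ℓ.Prime := Fact.out
  obtain ⟨v', 𝔓, h, c₀, hv', h𝔓, hfr, hc₀, hfix, -⟩ := hℓ
  have hvℓ : (Rat.HeightOneSpectrum.primesEquiv v : ℕ) = ℓ := primesEquiv_eq_of_natCast_mem hℓp hv
  have hvv : v' = v := by
    have h1 : (Rat.HeightOneSpectrum.primesEquiv v' : ℕ) = ℓ := primesEquiv_eq_of_natCast_mem hℓp hv'
    exact Rat.HeightOneSpectrum.primesEquiv.injective (Subtype.ext (h1.trans hvℓ.symm))
  rw [hvv] at h𝔓
  obtain ⟨σ₀, 𝔓₀, h𝔓₀, hσ₀, hcount⟩ :=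
    Summit.BirchSwinnertonDyer.Rank1Residual.GaloisImage.FrobShape.exists_frobenius_natCard_fixed_eq
      W 2 ℓ hℓ2 hgoodℓ hv
  have hc1 := hcount 1
  rw [pow_one] at hc1
  rw [← hc1]
  obtain ⟨g, hg⟩ := IsDedekindDomain.HeightOneSpectrum.exists_smul_eq_of_mem_primesAbove_holds h𝔓₀ h𝔓
  have hσ₁ : IsArithFrobAt (NumberField.RingOfIntegers ℚ) (g * σ₀ * g⁻¹) 𝔓 := hg ▸ hσ₀.conj g
  have hI := hfr.mul_inv_mem_inertia hσ₁
  have hgood : W.HasGoodReductionAt v := (hasGoodReductionAtPrime_primesEquiv_iff_holds W v ℓ hvℓ).mp hgoodℓ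
  have h2v : (2 : NumberField.RingOfIntegers ℚ) ∉ v.asIdeal := fun h2 ↦
    hℓ2 (hvℓ.symm.trans (primesEquiv_eq_of_natCast_mem Nat.prime_two (by exact_mod_cast h2)))
  have h2v' : ((((2 : ℕ) : ℤ)) : NumberField.RingOfIntegers ℚ) ∉ v.asIdeal := by
    rw [Int.cast_natCast]; exact_mod_cast h2v
  have hσσ₁ : ∀ P : geomTorsion W ((2 : ℕ) : ℤ), h • P = (g * σ₀ * g⁻¹) • P := fun P ↦ by
    have h' := W.smul_geomTorsion_eq_of_mem_inertia hgood h2v' h𝔓 hI ((g * σ₀ * g⁻¹) • P)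
    rwa [mul_smul, inv_smul_smul] at h'
  -- fixed points of `σ₀` ↔ fixed points of `c₀`, via `P ↦ g • P`
  have hiff : ∀ P : geomTorsion W ((2 : ℕ) : ℤ), σ₀ • P = P ↔ c₀ • (g • P) = g • P := fun P ↦ by
    rw [← hfix (g • P), hσσ₁, mul_smul, mul_smul, inv_smul_smul]
    constructor
    · intro hP; rw [hP]
    · intro hP; exact smul_left_cancel g hP
  have hcongr : Nat.card {P : geomTorsion W ((2 : ℕ) : ℤ) // σ₀ • P = P} =
      Nat.card {P : geomTorsion W ((2 : ℕ) : ℤ) // c₀ • P = P} := by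
    refine Nat.card_congr
      { toFun := fun P ↦ ⟨g • P.1, (hiff P.1).mp P.2⟩
        invFun := fun Q ↦ ⟨g⁻¹ • Q.1, (hiff _).mpr (by rw [smul_inv_smul]; exact Q.2)⟩
        left_inv := fun P ↦ Subtype.ext (inv_smul_smul g P.1)
        right_inv := fun Q ↦ Subtype.ext (smul_inv_smul g Q.1) }
  rw [hcongr]
  exact natCard_twoTorsion_fixed_eq_two_of_Δ_neg W hΔ hc₀

end Summit.BirchSwinnertonDyer.BirchSwinnertonDyer.Theorems.GenusKolySign

end
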